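import Literature.NumberTheory.Sieve.MatomakiRadziwillProp1Partition
import HarnessLib

/-!
# Matomäki–Radziwiłł 2016, Proposition 1 — part (b): the bound for `E_1` (§8.1)

Topic `NumberTheory/Sieve`; second file of the assembly of `MatomakiRadziwill2016_prop1` (Proposition 1
of Matomäki–Radziwiłł, Ann. of Math. 183 (2016), §8), continuing
`MatomakiRadziwillProp1Partition.lean` (the partition `[T₀, T] = ⋃ⱼ 𝒯ⱼ ∪ 𝒰`, the parameters `H_j`,
`α_j`, `ℐ_j` and the reduction (23) by Lemma 12).  Everything here is proved; no new definitions.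

§8.1 of the paper: "If `j = 1`, then by the mean-value theorem (Lemma 6), we get
`E_1 ≪ H_1 log Q_1 · ∑_{v ∈ ℐ_1} e^{-2α_1 v/H_1} · (T + X/e^{v/H_1}) · 1/(X/e^{v/H_1})
 ≪ H_1 log Q_1 · P_1^{-2α_1} · 1/(1 - e^{-2α_1/H_1}) · (T/(X/Q_1) + 1)
 ≪ H_1² log Q_1 · P_1^{-1/2+3η} (T/(X/Q_1) + 1) ≪ (T/(X/Q_1) + 1) (log Q_1)^{1/3}/P_1^{1/6-η}`
by the choice of `H_1`."  Here, with the explicit constant `C₁₂ = 20000` of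
`MatomakiRadziwill2016_lemma12_decomp_holds` and `E_1` in the form produced by
`SieveIntervalSystem.integral_le_sum_Tset_add_Uset`:

* `integral_blockCofactorPoly_le` — Lemma 6 for the cofactor polynomial:
  `∫_𝒯 |R_{v,H}(1+it)|² dt ≤ 10 T e^{v/H}/X + 72` (`|b_m| ≤ 1`, `𝒯 ⊆ [-T, T]`, `X e^{-v/H} ≥ 1`);
* `E_one_le` — **the bound for `E_1`**: for `0 < η < 1/6`, `X ≥ e`, `T ≥ 1`, `T₀ ≥ 0`, `H₁ ≥ 1`,
  `C₁₂ H₁ log(Q₁/P₁) ∑_{v∈ℐ₁} ∫_{𝒯₁} |Q_{v,H₁} R_{v,H₁}|² ≤ 2880000 (1 + 1/(2α₁)) (T Q₁/X + 1) / H₁`,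
  `α₁ = 1/4 - 3η/2`, `1/H₁ = (log Q₁)^{1/3}/P₁^{1/6-η}` (`SieveIntervalSystem.one_div_Hpar_one`);
* on the way: `Hpar_one_cube_mul` (`H₁³ log Q₁ P₁^{-1/2+3η} = 1`, "the choice of `H₁`"),
  `exp_div_Hpar_le` (`e^{v/H_j} ≤ Q_j` on `ℐ_j`), `Hpar_mul_log_P_lt`, `Q_one_le_X`, and the
  elementary `one_div_one_sub_exp_neg_le` (`1/(1-e^{-c}) ≤ 1 + 1/c`), `sum_Icc_pow_le`.

The dependence on `η` of the constant (`1/(2α₁) → ∞` as `η → 1/6`) is genuine and harmless: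
Proposition 1 fixes `η` before its constant.

## References

* K. Matomäki, M. Radziwiłł, *Multiplicative functions in short intervals*, Ann. of Math. (2) 183
  (2016), 1015–1056, doi:10.4007/annals.2016.183.3.6, arXiv:1501.04585: §8.1 (arXiv p. 16).
-/

noncomputable section

open Finset Complex MeasureTheory

namespace Literature.NumberTheory.Sieve

namespace SieveIntervalSystem

variable {η X : ℝ} (I : SieveIntervalSystem η X)

/-! ### Elementary inequalities -/

/-- `1/(1 - e^{-c}) ≤ 1 + 1/c` for `c > 0` (from `e^c ≥ 1 + c`). [folklore] -/
theorem one_div_one_sub_exp_neg_le {c : ℝ} (hc : 0 < c) :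
    1 / (1 - Real.exp (-c)) ≤ 1 + 1 / c := by
  have h1 : 1 + c ≤ Real.exp c := by linarith [Real.add_one_le_exp c]
  have hexp : Real.exp (-c) ≤ 1 / (1 + c) := by
    rw [Real.exp_neg, inv_eq_one_div]
    exact one_div_le_one_div_of_le (by linarith) h1
  have hpos : 0 < 1 - Real.exp (-c) := by
    have : Real.exp (-c) < 1 := Real.exp_lt_one_iff.2 (by linarith)
    linarith
  rw [div_le_iff₀ hpos]
  have : (1 + 1 / c) * (1 - Real.exp (-c)) ≥ (1 + 1 / c) * (1 - 1 / (1 + c)) :=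
    mul_le_mul_of_nonneg_left (by linarith) (by positivity)
  have hid : (1 + 1 / c) * (1 - 1 / (1 + c)) = 1 := by
    field_simp
    ring
  linarith

/-- A geometric sum over a block range: `∑_{v₀ ≤ v ≤ v₁} r^v ≤ r^{v₀}/(1-r)` for `0 ≤ r < 1`. [folklore] -/
theorem sum_Icc_pow_le {r : ℝ} (hr0 : 0 ≤ r) (hr1 : r < 1) (v₀ v₁ : ℕ) :
    ∑ v ∈ Icc v₀ v₁, r ^ v ≤ r ^ v₀ / (1 - r) := by
  rw [← Finset.Ico_add_one_right_eq_Icc]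
  exact geom_sum_Ico_le_of_lt_one hr0 hr1

/-! ### The cofactor polynomials `R_{v,H}` on `[-T, T]` (Lemma 6) -/

/-- **Mean value of `R_{v,H}`** (§8.1: "by the mean-value theorem (Lemma 6), we get
`∫ |R_{v,H_1}|² ≪ (T + X/e^{v/H_1}) · 1/(X/e^{v/H_1})`"), explicitly: for `|b_m| ≤ 1`, `T > 0`,
`𝒯 ⊆ [-T, T]` and `X e^{-v/H} ≥ 1`,
`∫_𝒯 |R_{v,H}(1+it)|² dt ≤ 10 T e^{v/H}/X + 72`. [cite: MatomakiRadziwillAnnals2016, §8.1] -/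
theorem integral_blockCofactorPoly_le {b : ℕ → ℂ} (hb : ∀ m, ‖b m‖ ≤ 1) (P Q : ℝ) {H : ℝ}
    {T : ℝ} (hT : 0 < T) {𝒯 : Set ℝ} (h𝒯 : 𝒯 ⊆ Set.Icc (-T) T) (hX : 0 < X) (v : ℕ)
    (hE : 1 ≤ X * Real.exp (-((v : ℝ) / H))) :
    ∫ t in 𝒯, ‖blockCofactorPoly b X P Q H v t‖ ^ 2 ≤
      10 * T * Real.exp ((v : ℝ) / H) / X + 72 := by
  set E := Real.exp (-((v : ℝ) / H)) with hEdef
  have hE0 : 0 < E := Real.exp_pos _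
  have hXE : 0 < X * E := by positivity
  -- rewrite `R` as a Dirichlet polynomial `∑ d_m m^{-1-it}` over `M_v`
  have hR : ∀ t : ℝ, blockCofactorPoly b X P Q H v t =
      ∑ m ∈ Icc ⌈X * E⌉₊ ⌊2 * X * E⌋₊,
        (b m * ((1 : ℂ) / ((primeDivisorsIn P Q m : ℂ) + 1))) *
          (m : ℂ) ^ (-(1 + (t : ℂ) * Complex.I)) := by
    intro t
    unfold blockCofactorPoly
    refine sum_congr rfl fun m _ => ?_
    ring
  simp_rw [hR]
  have hsub : Icc ⌈X * E⌉₊ ⌊2 * X * E⌋₊ ⊆ Icc 1 ⌊2 * X * E⌋₊ := by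
    intro m hm
    rw [mem_Icc] at hm ⊢
    exact ⟨(Nat.one_le_iff_ne_zero.2 (Nat.ceil_pos.2 hXE).ne').trans hm.1, hm.2⟩
  refine (MatomakiRadziwillLemma12.meanvalue_subset _ _ hsub _ hT h𝒯).trans ?_
  -- coefficients `≤ 1`, `m ≥ X E`, `#M_v ≤ X E + 1 ≤ 2 X E`
  have hterm : ∀ m ∈ Icc ⌈X * E⌉₊ ⌊2 * X * E⌋₊,
      ‖b m * ((1 : ℂ) / ((primeDivisorsIn P Q m : ℂ) + 1))‖ ^ 2 / (m : ℝ) ^ 2 ≤ 1 / (X * E) ^ 2 := by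
    intro m hm
    have hmE : X * E ≤ m := Nat.ceil_le.1 (mem_Icc.1 hm).1
    have h1 : ‖b m * ((1 : ℂ) / ((primeDivisorsIn P Q m : ℂ) + 1))‖ ≤ 1 := by
      rw [norm_mul, MatomakiRadziwillLemma12.norm_wt]
      have := hb m
      have h2 : 1 / ((primeDivisorsIn P Q m : ℝ) + 1) ≤ 1 := by
        rw [div_le_one (by positivity)]; linarith [(Nat.cast_nonneg (primeDivisorsIn P Q m) : (0:ℝ) ≤ _)]
      exact mul_le_one₀ this (by positivity) h2
    have h1' : ‖b m * ((1 : ℂ) / ((primeDivisorsIn P Q m : ℂ) + 1))‖ ^ 2 ≤ 1 := by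
      have h0 := norm_nonneg (b m * ((1 : ℂ) / ((primeDivisorsIn P Q m : ℂ) + 1)))
      nlinarith only [h1, h0]
    calc _ ≤ 1 / (m : ℝ) ^ 2 := div_le_div_of_nonneg_right h1' (by positivity)
      _ ≤ 1 / (X * E) ^ 2 := div_le_div_of_nonneg_left zero_le_one (by positivity)
          (pow_le_pow_left₀ hXE.le hmE 2)
  have hcard : (#(Icc ⌈X * E⌉₊ ⌊2 * X * E⌋₊) : ℝ) ≤ 2 * (X * E) := by
    rw [Nat.card_Icc]
    rcases le_or_gt ⌈X * E⌉₊ (⌊2 * X * E⌋₊ + 1) with hle | hlt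
    · rw [Nat.cast_sub hle]
      push_cast
      have h1 : (⌊2 * X * E⌋₊ : ℝ) ≤ 2 * X * E := Nat.floor_le (by positivity)
      have h2 : X * E ≤ ⌈X * E⌉₊ := Nat.le_ceil _
      linarith
    · rw [Nat.sub_eq_zero_of_le hlt.le]
      push_cast
      positivity
  have hN : (⌊2 * X * E⌋₊ : ℝ) ≤ 2 * X * E := Nat.floor_le (by positivity)
  calc (5 * T + 18 * (⌊2 * X * E⌋₊ : ℝ)) *
        ∑ m ∈ Icc ⌈X * E⌉₊ ⌊2 * X * E⌋₊,
          ‖b m * ((1 : ℂ) / ((primeDivisorsIn P Q m : ℂ) + 1))‖ ^ 2 / (m : ℝ) ^ 2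
      ≤ (5 * T + 36 * (X * E)) * ∑ m ∈ Icc ⌈X * E⌉₊ ⌊2 * X * E⌋₊, (1 / (X * E) ^ 2 : ℝ) :=
        mul_le_mul (by linarith) (sum_le_sum hterm) (sum_nonneg fun _ _ => by positivity)
          (by positivity)
    _ = (5 * T + 36 * (X * E)) * (#(Icc ⌈X * E⌉₊ ⌊2 * X * E⌋₊) * (1 / (X * E) ^ 2)) := by
        rw [sum_const, nsmul_eq_mul]
    _ ≤ (5 * T + 36 * (X * E)) * (2 * (X * E) * (1 / (X * E) ^ 2)) := by gcongr
    _ = 10 * T * (1 / (X * E)) + 72 := by field_simp; ring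
    _ = 10 * T * Real.exp ((v : ℝ) / H) / X + 72 := by
        rw [hEdef, Real.exp_neg]
        field_simp

/-! ### The parameters of the first level -/

/-- `α₁ = 1/4 - 3η/2`. [folklore] -/
theorem alpha_one (η : ℝ) : alpha η 1 = 1 / 4 - 3 / 2 * η := by
  unfold alpha; norm_num; ring

/-- **The key identity behind §8.1**: `H₁³ · log Q₁ · P₁^{-1/2+3η} = 1`, i.e.
`H₁² log Q₁ P₁^{-2α₁} = 1/H₁ = (log Q₁)^{1/3}/P₁^{1/6-η}` ("by the choice of `H₁`").
[cite: MatomakiRadziwillAnnals2016, §8.1] -/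
theorem Hpar_one_cube_mul (hη : 0 < η) (hη' : η ≤ 8) :
    I.Hpar 1 ^ 3 * Real.log (I.Q 1) * I.P 1 ^ (-(1 / 2 : ℝ) + 3 * η) = 1 := by
  have hP : 0 < I.P 1 := I.pos_P 1 le_rfl
  have hL : 0 < Real.log (I.Q 1) := by linarith [I.one_lt_log_Q_one hη hη']
  unfold Hpar
  simp only [Nat.cast_one, one_pow, one_mul]
  rw [div_pow, ← Real.rpow_natCast (I.P 1 ^ (1 / 6 - η)) 3, ← Real.rpow_mul hP.le,
    ← Real.rpow_natCast (Real.log (I.Q 1) ^ (1 / 3 : ℝ)) 3, ← Real.rpow_mul hL.le]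
  norm_num
  rw [div_mul_cancel₀ _ hL.ne', ← Real.rpow_add hP]
  have : (1 / 6 - η) * 3 + (-(1 / 2) + 3 * η) = 0 := by ring
  rw [this, Real.rpow_zero]

/-- For `v ∈ ℐ_j`: `v ≤ H_j log Q_j`, hence `e^{v/H_j} ≤ Q_j` (`H_j > 0`, `Q_j ≥ 1`). [folklore] -/
theorem exp_div_Hpar_le (hη : 0 < η) (hη' : η ≤ 8) {j v : ℕ} (hj : 1 ≤ j) (hv : v ∈ I.blocks j)
    (hH : 0 < I.Hpar j) : Real.exp ((v : ℝ) / I.Hpar j) ≤ I.Q j := by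
  have hQ1 : 1 ≤ I.Q j := I.one_le_Q hη hη' hj
  have hlogQ : 0 ≤ I.Hpar j * Real.log (I.Q j) := mul_nonneg hH.le (Real.log_nonneg hQ1)
  have hv' : (v : ℝ) ≤ I.Hpar j * Real.log (I.Q j) :=
    (Nat.le_floor_iff hlogQ).1 (mem_Icc.1 (by unfold blocks at hv; exact hv)).2
  calc Real.exp ((v : ℝ) / I.Hpar j) ≤ Real.exp (Real.log (I.Q j)) := by
        apply Real.exp_le_exp.2
        rw [div_le_iff₀ hH]
        linarith
    _ = I.Q j := Real.exp_log (by linarith)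

/-- For `v ∈ ℐ_j`: `H_j log P_j - 1 < v`. [folklore] -/
theorem Hpar_mul_log_P_lt {j v : ℕ} (hv : v ∈ I.blocks j) :
    I.Hpar j * Real.log (I.P j) - 1 < v := by
  have h := (mem_Icc.1 (by unfold blocks at hv; exact hv)).1
  have h2 : I.Hpar j * Real.log (I.P j) < ⌊I.Hpar j * Real.log (I.P j)⌋₊ + 1 := Nat.lt_floor_add_one _
  have h3 : (⌊I.Hpar j * Real.log (I.P j)⌋₊ : ℝ) ≤ v := by exact_mod_cast h
  linarith

/-- `Q₁ ≤ exp(√log X) ≤ X` when `X ≥ e`. [folklore] -/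
theorem Q_one_le_X (hη : 0 < η) (hη' : η ≤ 8) (hXe : Real.exp 1 ≤ X) : I.Q 1 ≤ X := by
  have hX0 : 0 < X := (Real.exp_pos 1).trans_le hXe
  have hX : 1 ≤ Real.log X := (Real.le_log_iff_exp_le hX0).2 hXe
  have hsqrt : Real.sqrt (Real.log X) ≤ Real.log X := by
    have h1 : 1 ≤ Real.sqrt (Real.log X) := by
      rw [show (1:ℝ) = Real.sqrt 1 from Real.sqrt_one.symm]
      exact Real.sqrt_le_sqrt hX
    have h2 := Real.sq_sqrt (show 0 ≤ Real.log X by linarith)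
    nlinarith
  calc I.Q 1 ≤ Real.exp (Real.sqrt (Real.log X)) := I.Q_one_le hη hη'
    _ ≤ Real.exp (Real.log X) := Real.exp_le_exp.2 hsqrt
    _ = X := Real.exp_log hX0

/-! ### The bound for `E_1` -/

/-- **§8.1, the bound for `E_1`**: with `C₁₂ = 20000`, `α₁ = 1/4 - 3η/2 > 0` (`0 < η < 1/6`),
`log X ≥ 1`, `T ≥ 1`, `T₀ ≥ 0` and `H₁ ≥ 1`,
`C₁₂ · H₁ log(Q₁/P₁) · ∑_{v ∈ ℐ₁} ∫_{𝒯₁} |Q_{v,H₁} R_{v,H₁}|² dt ≤ 5760000 (1 + 1/(2α₁)) (T Q₁/X + 1) / H₁`,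
where `1/H₁ = (log Q₁)^{1/3}/P₁^{1/6-η}`.  Proof as printed: on `𝒯₁`, `|Q_{v,H₁}| ≤ e^{-α₁ v/H₁}`; the
mean value theorem for `R_{v,H₁}` (`integral_blockCofactorPoly_le`); the geometric series
`∑_{v ≥ H₁ log P₁ - 1} e^{-2α₁v/H₁} ≤ e^{1/2} P₁^{-2α₁} (1 + H₁/(2α₁))`; and `H₁² log Q₁ P₁^{-2α₁} = 1/H₁`
(`Hpar_one_cube_mul`). [cite: MatomakiRadziwillAnnals2016, §8.1] -/
theorem E_one_le (hη : 0 < η) (hη6 : η < 1 / 6) (f : ArithmeticFunction ℝ)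
    (hf1 : ∀ n, |f n| ≤ 1) (hXe : Real.exp 1 ≤ X) {T₀ T : ℝ} (hT₀ : 0 ≤ T₀) (hT : 1 ≤ T)
    (hH1 : 1 ≤ I.Hpar 1) :
    20000 * ((I.Hpar 1 * Real.log (I.Q 1 / I.P 1)) *
        (∑ v ∈ I.blocks 1, ∫ t in I.Tset (fun p => ((f p : ℝ) : ℂ)) T₀ T 1,
          ‖blockPrimePoly (fun p => ((f p : ℝ) : ℂ)) (I.P 1) (I.Q 1) (I.Hpar 1) v t *
            blockCofactorPoly (I.bCoef f 1) X (I.P 1) (I.Q 1) (I.Hpar 1) v t‖ ^ 2)) ≤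
      2880000 * (1 + 1 / (2 * alpha η 1)) * (T * I.Q 1 / X + 1) * (1 / I.Hpar 1) := by
  have hη' : η ≤ 8 := by linarith
  have hα : 0 < alpha η 1 := by rw [alpha_one]; linarith
  have hα4 : alpha η 1 < 1 / 4 := by rw [alpha_one]; linarith
  have hP : 0 < I.P 1 := I.pos_P 1 le_rfl
  have hP1 : 1 ≤ I.P 1 := I.one_le_P_one
  have hQ1 : 1 ≤ I.Q 1 := I.one_le_Q hη hη' le_rfl
  have hQ0 : 0 < I.Q 1 := by linarith
  have hL : 1 < Real.log (I.Q 1) := I.one_lt_log_Q_one hη hη'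
  have hlogP : 0 ≤ Real.log (I.P 1) := Real.log_nonneg hP1
  have hX0 : 0 < X := (Real.exp_pos 1).trans_le hXe
  have hQX : I.Q 1 ≤ X := I.Q_one_le_X hη hη' hXe
  have hH0 : 0 < I.Hpar 1 := by linarith
  have hT0 : 0 < T := by linarith
  have hR0 : 0 ≤ T * I.Q 1 / X + 1 := by positivity
  have hsubT : I.Tset (fun p => ((f p : ℝ) : ℂ)) T₀ T 1 ⊆ Set.Icc (-T) T :=
    (I.Tset_subset _ T₀ T 1).trans (Set.Icc_subset_Icc (by linarith) le_rfl)
  -- the ratio of the geometric series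
  have hκ0 : 0 < 2 * alpha η 1 / I.Hpar 1 := by positivity
  have hκ : 2 * alpha η 1 / I.Hpar 1 ≤ 1 / 2 := by
    rw [div_le_iff₀ hH0]; nlinarith
  have hr0 : 0 ≤ Real.exp (-(2 * alpha η 1 / I.Hpar 1)) := (Real.exp_pos _).le
  have hr1 : Real.exp (-(2 * alpha η 1 / I.Hpar 1)) < 1 := Real.exp_lt_one_iff.2 (by linarith)
  -- per-block bound
  have hblock : ∀ v ∈ I.blocks 1,
      ∫ t in I.Tset (fun p => ((f p : ℝ) : ℂ)) T₀ T 1,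
          ‖blockPrimePoly (fun p => ((f p : ℝ) : ℂ)) (I.P 1) (I.Q 1) (I.Hpar 1) v t *
            blockCofactorPoly (I.bCoef f 1) X (I.P 1) (I.Q 1) (I.Hpar 1) v t‖ ^ 2 ≤
        Real.exp (-(2 * alpha η 1 / I.Hpar 1)) ^ v * (72 * (T * I.Q 1 / X + 1)) := by
    intro v hv
    have hexpQ : Real.exp ((v : ℝ) / I.Hpar 1) ≤ I.Q 1 := I.exp_div_Hpar_le hη hη' le_rfl hv hH0
    have hE : 1 ≤ X * Real.exp (-((v : ℝ) / I.Hpar 1)) := by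
      rw [Real.exp_neg, ← div_eq_mul_inv, le_div_iff₀ (Real.exp_pos _), one_mul]
      exact hexpQ.trans hQX
    -- pointwise bound on `𝒯₁`
    have hpt : ∀ t ∈ I.Tset (fun p => ((f p : ℝ) : ℂ)) T₀ T 1,
        ‖blockPrimePoly (fun p => ((f p : ℝ) : ℂ)) (I.P 1) (I.Q 1) (I.Hpar 1) v t *
            blockCofactorPoly (I.bCoef f 1) X (I.P 1) (I.Q 1) (I.Hpar 1) v t‖ ^ 2 ≤
          Real.exp (-(2 * alpha η 1 / I.Hpar 1)) ^ v *
            ‖blockCofactorPoly (I.bCoef f 1) X (I.P 1) (I.Q 1) (I.Hpar 1) v t‖ ^ 2 := by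
      intro t ht
      have hgood : t ∈ I.goodSet (fun p => ((f p : ℝ) : ℂ)) 1 := ht.1.2
      have hQv : ‖blockPrimePoly (fun p => ((f p : ℝ) : ℂ)) (I.P 1) (I.Q 1) (I.Hpar 1) v t‖ ≤
          Real.exp (-(alpha η 1 * v / I.Hpar 1)) := by
        unfold goodSet at hgood
        have := Set.mem_iInter₂.1 hgood v hv
        exact this
      rw [norm_mul, mul_pow]
      have hexp_eq : Real.exp (-(2 * alpha η 1 / I.Hpar 1)) ^ v =
          Real.exp (-(alpha η 1 * v / I.Hpar 1)) ^ 2 := by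
        rw [← Real.exp_nat_mul, ← Real.exp_nat_mul]
        congr 1
        push_cast
        ring
      rw [hexp_eq]
      exact mul_le_mul_of_nonneg_right (pow_le_pow_left₀ (norm_nonneg _) hQv 2) (sq_nonneg _)
    -- integrate the pointwise bound
    have hcQ : Continuous fun t : ℝ =>
        blockPrimePoly (fun p => ((f p : ℝ) : ℂ)) (I.P 1) (I.Q 1) (I.Hpar 1) v t := by
      unfold blockPrimePoly; exact MatomakiRadziwillLemma12.continuous_dsum _ _
    have hcR : Continuous fun t : ℝ =>
        blockCofactorPoly (I.bCoef f 1) X (I.P 1) (I.Q 1) (I.Hpar 1) v t := by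
      unfold blockCofactorPoly
      exact continuous_finsetSum _ fun m _ =>
        (continuous_const.mul (MatomakiRadziwillLemma12.continuous_cpw m)).div_const _
    have hiQR : IntegrableOn (fun t : ℝ =>
        ‖blockPrimePoly (fun p => ((f p : ℝ) : ℂ)) (I.P 1) (I.Q 1) (I.Hpar 1) v t *
          blockCofactorPoly (I.bCoef f 1) X (I.P 1) (I.Q 1) (I.Hpar 1) v t‖ ^ 2)
        (I.Tset (fun p => ((f p : ℝ) : ℂ)) T₀ T 1) :=
      MatomakiRadziwillLemma12.integrableOn_of_continuous ((hcQ.mul hcR).norm.pow 2) hsubT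
    have hiR : IntegrableOn (fun t : ℝ => Real.exp (-(2 * alpha η 1 / I.Hpar 1)) ^ v *
        ‖blockCofactorPoly (I.bCoef f 1) X (I.P 1) (I.Q 1) (I.Hpar 1) v t‖ ^ 2)
        (I.Tset (fun p => ((f p : ℝ) : ℂ)) T₀ T 1) :=
      MatomakiRadziwillLemma12.integrableOn_of_continuous
        (continuous_const.mul (hcR.norm.pow 2)) hsubT
    calc ∫ t in I.Tset (fun p => ((f p : ℝ) : ℂ)) T₀ T 1,
          ‖blockPrimePoly (fun p => ((f p : ℝ) : ℂ)) (I.P 1) (I.Q 1) (I.Hpar 1) v t *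
            blockCofactorPoly (I.bCoef f 1) X (I.P 1) (I.Q 1) (I.Hpar 1) v t‖ ^ 2
        ≤ ∫ t in I.Tset (fun p => ((f p : ℝ) : ℂ)) T₀ T 1,
            Real.exp (-(2 * alpha η 1 / I.Hpar 1)) ^ v *
              ‖blockCofactorPoly (I.bCoef f 1) X (I.P 1) (I.Q 1) (I.Hpar 1) v t‖ ^ 2 :=
          setIntegral_mono_on hiQR hiR (I.measurableSet_Tset _ T₀ T 1) hpt
      _ = Real.exp (-(2 * alpha η 1 / I.Hpar 1)) ^ v *
            ∫ t in I.Tset (fun p => ((f p : ℝ) : ℂ)) T₀ T 1,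
              ‖blockCofactorPoly (I.bCoef f 1) X (I.P 1) (I.Q 1) (I.Hpar 1) v t‖ ^ 2 :=
          integral_const_mul _ _
      _ ≤ Real.exp (-(2 * alpha η 1 / I.Hpar 1)) ^ v *
            (10 * T * Real.exp ((v : ℝ) / I.Hpar 1) / X + 72) :=
          mul_le_mul_of_nonneg_left (integral_blockCofactorPoly_le (I.norm_bCoef_le hf1 1)
            (I.P 1) (I.Q 1) hT0 hsubT hX0 v hE) (pow_nonneg hr0 v)
      _ ≤ Real.exp (-(2 * alpha η 1 / I.Hpar 1)) ^ v * (72 * (T * I.Q 1 / X + 1)) := by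
          refine mul_le_mul_of_nonneg_left ?_ (pow_nonneg hr0 v)
          have h0 : T * Real.exp ((v : ℝ) / I.Hpar 1) / X ≤ T * I.Q 1 / X :=
            div_le_div_of_nonneg_right (mul_le_mul_of_nonneg_left hexpQ hT0.le) hX0.le
          have e1 : 10 * T * Real.exp ((v : ℝ) / I.Hpar 1) / X =
              10 * (T * Real.exp ((v : ℝ) / I.Hpar 1) / X) := by ring
          have h72 : 0 ≤ T * I.Q 1 / X := by positivity
          linarith [h0, e1, h72]
  -- sum over the blocks and the geometric series
  have hsum : ∑ v ∈ I.blocks 1, ∫ t in I.Tset (fun p => ((f p : ℝ) : ℂ)) T₀ T 1,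
        ‖blockPrimePoly (fun p => ((f p : ℝ) : ℂ)) (I.P 1) (I.Q 1) (I.Hpar 1) v t *
          blockCofactorPoly (I.bCoef f 1) X (I.P 1) (I.Q 1) (I.Hpar 1) v t‖ ^ 2 ≤
      (∑ v ∈ I.blocks 1, Real.exp (-(2 * alpha η 1 / I.Hpar 1)) ^ v) * (72 * (T * I.Q 1 / X + 1)) := by
    rw [sum_mul]
    exact sum_le_sum hblock
  have hgeom : ∑ v ∈ I.blocks 1, Real.exp (-(2 * alpha η 1 / I.Hpar 1)) ^ v ≤
      2 * I.P 1 ^ (-(1 / 2 : ℝ) + 3 * η) * (1 + I.Hpar 1 / (2 * alpha η 1)) := by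
    unfold blocks
    refine (sum_Icc_pow_le hr0 hr1 _ _).trans ?_
    rw [div_eq_mul_one_div]
    refine mul_le_mul ?_ ?_ (by positivity) (by positivity)
    · -- `r^{v₀} ≤ e^{1/2} P₁^{-2α₁} ≤ 2 P₁^{-2α₁}`
      have hv₀ : I.Hpar 1 * Real.log (I.P 1) - 1 < ⌊I.Hpar 1 * Real.log (I.P 1)⌋₊ := by
        linarith [Nat.lt_floor_add_one (I.Hpar 1 * Real.log (I.P 1))]
      rw [← Real.exp_nat_mul]
      have he : Real.exp (1 / 2) ≤ 2 := by
        have h1 : Real.exp (1 / 2) * Real.exp (1 / 2) = Real.exp 1 := by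
          rw [← Real.exp_add]; norm_num
        have h2 := Real.exp_one_lt_d9
        nlinarith [Real.exp_pos (1 / 2)]
      calc Real.exp ((⌊I.Hpar 1 * Real.log (I.P 1)⌋₊ : ℕ) * -(2 * alpha η 1 / I.Hpar 1))
          ≤ Real.exp (1 / 2 + Real.log (I.P 1) * (-(1 / 2) + 3 * η)) := by
            apply Real.exp_le_exp.2
            have hmul := mul_lt_mul_of_pos_left hv₀ hκ0
            have hid : 2 * alpha η 1 / I.Hpar 1 * (I.Hpar 1 * Real.log (I.P 1) - 1) =
                2 * alpha η 1 * Real.log (I.P 1) - 2 * alpha η 1 / I.Hpar 1 := by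
              field_simp
            have hα1 : 2 * alpha η 1 = 1 / 2 - 3 * η := by rw [alpha_one]; ring
            rw [hid] at hmul
            nlinarith
        _ = Real.exp (1 / 2) * I.P 1 ^ (-(1 / 2 : ℝ) + 3 * η) := by
            rw [Real.exp_add, Real.rpow_def_of_pos hP]
        _ ≤ 2 * I.P 1 ^ (-(1 / 2 : ℝ) + 3 * η) :=
            mul_le_mul_of_nonneg_right he (by positivity)
    · -- `1/(1-r) ≤ 1 + H₁/(2α₁)`
      have := one_div_one_sub_exp_neg_le hκ0
      rwa [one_div_div] at this
  -- `log(Q₁/P₁) ≤ log Q₁`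
  have hlogQP : Real.log (I.Q 1 / I.P 1) ≤ Real.log (I.Q 1) := by
    rw [Real.log_div hQ0.ne' hP.ne']
    linarith
  have hS0 : 0 ≤ ∑ v ∈ I.blocks 1, ∫ t in I.Tset (fun p => ((f p : ℝ) : ℂ)) T₀ T 1,
      ‖blockPrimePoly (fun p => ((f p : ℝ) : ℂ)) (I.P 1) (I.Q 1) (I.Hpar 1) v t *
        blockCofactorPoly (I.bCoef f 1) X (I.P 1) (I.Q 1) (I.Hpar 1) v t‖ ^ 2 :=
    sum_nonneg fun v _ => integral_nonneg fun t => by positivity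
  -- the key identity
  have hkey : I.Hpar 1 * Real.log (I.Q 1) * I.P 1 ^ (-(1 / 2 : ℝ) + 3 * η) *
      (1 + I.Hpar 1 / (2 * alpha η 1)) ≤ (1 + 1 / (2 * alpha η 1)) * (1 / I.Hpar 1) := by
    have hE : 1 + I.Hpar 1 / (2 * alpha η 1) ≤ I.Hpar 1 * (1 + 1 / (2 * alpha η 1)) := by
      rw [mul_add, mul_one, mul_one_div]
      linarith
    have hcube := I.Hpar_one_cube_mul hη hη'
    calc I.Hpar 1 * Real.log (I.Q 1) * I.P 1 ^ (-(1 / 2 : ℝ) + 3 * η) * (1 + I.Hpar 1 / (2 * alpha η 1))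
        ≤ I.Hpar 1 * Real.log (I.Q 1) * I.P 1 ^ (-(1 / 2 : ℝ) + 3 * η) *
            (I.Hpar 1 * (1 + 1 / (2 * alpha η 1))) :=
          mul_le_mul_of_nonneg_left hE (by positivity)
      _ = (1 + 1 / (2 * alpha η 1)) *
            (I.Hpar 1 ^ 3 * Real.log (I.Q 1) * I.P 1 ^ (-(1 / 2 : ℝ) + 3 * η)) / I.Hpar 1 := by
          field_simp
      _ = (1 + 1 / (2 * alpha η 1)) * (1 / I.Hpar 1) := by rw [hcube]; ring
  -- assemble
  calc 20000 * ((I.Hpar 1 * Real.log (I.Q 1 / I.P 1)) *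
        (∑ v ∈ I.blocks 1, ∫ t in I.Tset (fun p => ((f p : ℝ) : ℂ)) T₀ T 1,
          ‖blockPrimePoly (fun p => ((f p : ℝ) : ℂ)) (I.P 1) (I.Q 1) (I.Hpar 1) v t *
            blockCofactorPoly (I.bCoef f 1) X (I.P 1) (I.Q 1) (I.Hpar 1) v t‖ ^ 2))
      ≤ 20000 * ((I.Hpar 1 * Real.log (I.Q 1)) *
          ((2 * I.P 1 ^ (-(1 / 2 : ℝ) + 3 * η) * (1 + I.Hpar 1 / (2 * alpha η 1))) *
            (72 * (T * I.Q 1 / X + 1)))) := by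
        gcongr 20000 * (?_ * ?_)
        · exact mul_le_mul_of_nonneg_left hlogQP hH0.le
        · exact hsum.trans (mul_le_mul_of_nonneg_right hgeom (by positivity))
    _ = 2880000 * (T * I.Q 1 / X + 1) *
          (I.Hpar 1 * Real.log (I.Q 1) * I.P 1 ^ (-(1 / 2 : ℝ) + 3 * η) *
            (1 + I.Hpar 1 / (2 * alpha η 1))) := by ring
    _ ≤ 2880000 * (T * I.Q 1 / X + 1) * ((1 + 1 / (2 * alpha η 1)) * (1 / I.Hpar 1)) :=
        mul_le_mul_of_nonneg_left hkey (by positivity)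
    _ = 2880000 * (1 + 1 / (2 * alpha η 1)) * (T * I.Q 1 / X + 1) * (1 / I.Hpar 1) := by ring


end SieveIntervalSystem

end Literature.NumberTheory.Sieve
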